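import Literature.Analysis.FluidPDE.SelfSimilar
import Literature.Analysis.FluidPDE.IsometryInvariance
import Literature.Analysis.FluidPDE.BoundedWeakIsometry
import Literature.Analysis.FluidPDE.AxisymmetricHeatFlow
import HarnessLib

/-!
# Isometry covariance of duality-form mild solutions and of the ancient / self-similar classes

Analysis/FluidPDE support file (everything proved; no definitions, no named facts). Let `E` be a
finite-dimensional real inner product space and `L : E ≃ₗᵢ[ℝ] E` a linear isometry (a rotation
or reflection). The Navier–Stokes equations are covariant under `u ↦ L u(t, L⁻¹ ·)`,
`f ↦ L f(t, L⁻¹ ·)` (Majda–Bertozzi 2002, §1.2, Prop. 1.1 (iii): rotation symmetry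
`v_Q(x, t) = Qᵗ v(Qx, t)`; Koch–Nadirashvili–Seregin–Šverák 2009, §1: the class of (bounded)
ancient mild solutions is invariant under the symmetries of the equations, and "a field `u` is
axi-symmetric if `u(Rx) = Ru(x)` for every rotation `R`" about the axis). The tree proves this
covariance for classical solutions (`IsClassicalNSSolutionOn.conj_linearIsometryEquiv`,
`IsometryInvariance.lean`), for KNSS's bounded weak class
(`IsBoundedWeakNSSolutionOn.conj_linearIsometryEquiv`, `BoundedWeakIsometry.lean`) and for the
Tao class (`TaoClassSymmetry.lean`); translations and scalings of the duality-form mild class are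
`IsMildNSSolutionBetween.comp_sub_right_zero` / `.comp_add_right` / `.nsRescale_zero`
(`KatoSymmetryCovariance.lean`, `SelfSimilar.lean`, `SelfSimilarProofs.lean`). This file adds the
missing **linear-isometry covariance of the duality-form (very weak / mild) classes**:

* `IsTestFunctionOn.conj_linearIsometryEquiv_top`, `heatFlow_conj_linearIsometryEquiv`,
  `heatTest_conj_linearIsometryEquiv`, `integral_inner_conj_linearIsometryEquiv` — the test
  class, the caloric test field `e^{ντΔ}φ` and the `L²` pairing are `O(E)`-covariant
  (the heat kernel is radial: `heatExtension_comp_linearIsometryEquiv`, `AxisymmetricHeatFlow.lean`);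
* `IsMildNSSolutionBetween.conj_linearIsometryEquiv` (forced; force conjugated as well) and
  `.conj_linearIsometryEquiv_zero` (unforced): the two-time duality identity of
  Fabes–Jones–Rivière 1972, Thm. 2.1, tested against `φ` for the conjugated field, is the identity
  for `u` tested against `L⁻¹ φ(L ·)` — term by term (`convect_conj_linearIsometryEquiv`);
  `IsMildNSSolutionFrom.conj_linearIsometryEquiv`, `IsMildNSSolutionOn.conj_linearIsometryEquiv`;
* `IsAncientMildSolution.conj_linearIsometryEquiv`, `IsBoundedOn.conj_linearIsometryEquiv`,
  `IsBoundedAncientMildSolution.conj_linearIsometryEquiv` (KNSS 2009, §1);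
* `HasTypeIDecay.conj_linearIsometryEquiv`, `HasTypeITimeDecay.conj_linearIsometryEquiv`
  (the Type I bounds (1.4), (1.6) of KNSS 2009 only see `‖x‖ = ‖L⁻¹ x‖`);
* `nsRescale_conj_linearIsometryEquiv`, `IsDiscretelySelfSimilar.conj_linearIsometryEquiv`,
  `IsSelfSimilar.conj_linearIsometryEquiv`, `IsRotatedDSS.conj_linearIsometryEquiv` (the
  conjugate of a rotated `λ`-DSS field with rotation `R` is rotated `λ`-DSS with rotation
  `L R L⁻¹`; Chae–Wolf 2017, Def. 1.1).

Typical use: transporting a statement about fields axisymmetric about the `x₃`-axis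
(`IsAxisymmetric`) to fields axisymmetric about any axis `L e₃`, i.e. to `u` with
`IsAxisymmetric (L⁻¹ ∘ u t ∘ L)` (`AncientAxisymmetricTypeILiouville.lean`).

## Mathlib / tree search

Tree (`lean search 'conj_linearIsometryEquiv|comp_linearIsometryEquiv' --decl`): pointwise
covariance `fderiv_/convect_/divergence_conj_linearIsometryEquiv`,
`VectorCalculus.IsDivFree.conj_linearIsometryEquiv` (`IsometryInvariance.lean`);
`IsWeaklyDivFree.conj_linearIsometryEquiv` (`BoundedWeakIsometry.lean`);
`heatExtension_comp_linearIsometryEquiv`, `heatExtension_continuousLinearEquiv_comp`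
(`AxisymmetricHeatFlow.lean`; the `E`-valued conjugated form is also
`heatExtension_conj_linearIsometryEquiv` in the heavier `OseenZoomCovariance.lean`); no prior
statement for `IsMildNSSolutionBetween` / `IsAncientMildSolution` / `HasTypeIDecay` /
`IsRotatedDSS` under isometries. Mathlib: `LinearIsometryEquiv.measurePreserving`,
`MeasurePreserving.integral_comp`, `LinearIsometryEquiv.inner_map_eq_flip`,
`HasCompactSupport.comp_homeomorph`, `HasCompactSupport.comp_left`.

## References

* G. Koch, N. Nadirashvili, G. Seregin, V. Šverák, *Liouville theorems for the Navier–Stokes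
  equations and applications*, Acta Math. 203 (2009) 83–105 = arXiv:0709.3599, §1 ((1.4),
  (1.5), (1.6); symmetries of the class of ancient mild solutions). [KochNadirashviliSereginSverak2009]
* A. J. Majda, A. L. Bertozzi, *Vorticity and Incompressible Flow*, CUP 2002, §1.2,
  Prop. 1.1 (iii) (rotation symmetry). [MajdaBertozziCUP2002]
* E. B. Fabes, B. F. Jones, N. M. Rivière, Arch. Rational Mech. Anal. 45 (1972), Thm. 2.1
  (duality form of mild solutions). [FabesJonesRiviere1972]
* D. Chae, J. Wolf, *Existence of discretely self-similar solutions to the Navier–Stokes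
  equations for initial value in `L²_loc(ℝ³)`*, 2017/2018, Def. 1.1 (rotated `λ`-DSS). [ChaeWolf2017]
-/

noncomputable section

open MeasureTheory TopologicalSpace Set Function Filter
open scoped InnerProductSpace RealInnerProductSpace

namespace Literature.Analysis.FluidPDE

/-! ### Conjugated test functions, heat flow and pairings -/

section TestFunction

variable {E : Type*} [NormedAddCommGroup E] [InnerProductSpace ℝ E]

/-- A test function on the whole space conjugated by a linear isometry, `x ↦ L (φ (L⁻¹ x))`, is a
test function on the whole space (Evans, *PDE*, §5.2.1; the support is the image under `L` of the
support of `φ`; Majda–Bertozzi 2002, Prop. 1.1 (iii): rotated test fields). [cite: MajdaBertozziCUP2002, §1.2 Prop. 1.1 (iii)] -/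
theorem _root_.Literature.Analysis.FunctionSpaces.IsTestFunctionOn.conj_linearIsometryEquiv_top
    (L : E ≃ₗᵢ[ℝ] E) {φ : E → E} (hφ : FunctionSpaces.IsTestFunctionOn (⊤ : Opens E) φ) :
    FunctionSpaces.IsTestFunctionOn (⊤ : Opens E) (fun x => L (φ (L.symm x))) where
  contDiff := L.toContinuousLinearEquiv.contDiff.comp
    (hφ.contDiff.comp L.symm.toContinuousLinearEquiv.contDiff)
  hasCompactSupport := by
    have h1 : HasCompactSupport (φ ∘ ⇑L.symm.toContinuousLinearEquiv.toHomeomorph) :=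
      hφ.hasCompactSupport.comp_homeomorph L.symm.toContinuousLinearEquiv.toHomeomorph
    exact h1.comp_left (g := fun y => L y) (map_zero L)
  tsupport_subset := by simp

end TestFunction

section Heat

variable {E : Type*} [NormedAddCommGroup E] [InnerProductSpace ℝ E] [FiniteDimensional ℝ E]
  [MeasurableSpace E] [BorelSpace E]

/-- **The heat flow is `O(E)`-covariant**: `e^{tΔ}(L φ(L⁻¹ ·))(x) = L (e^{tΔ}φ)(L⁻¹ x)`, for every
`t` including the junk range `t ≤ 0` where `heatFlow` is the identity (the heat kernel is radial
and `L` preserves Lebesgue measure: `heatExtension_comp_linearIsometryEquiv`; `L` commutes with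
the Bochner integral: `heatExtension_continuousLinearEquiv_comp`; Evans, *PDE*, §2.3.1: the
fundamental solution `Φ(x, t)` is radial in `x`). [cite: Evans2010, §2.3.1] -/
theorem heatFlow_conj_linearIsometryEquiv (L : E ≃ₗᵢ[ℝ] E) (φ : E → E) (t : ℝ) (x : E) :
    heatFlow (fun y => L (φ (L.symm y))) t x = L (heatFlow φ t (L.symm x)) := by
  rcases le_or_gt t 0 with ht | ht
  · rw [heatFlow_of_nonpos _ ht, heatFlow_of_nonpos _ ht]
  · rw [heatFlow_of_pos _ ht, heatFlow_of_pos _ ht]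
    have h1 := heatExtension_continuousLinearEquiv_comp L.toContinuousLinearEquiv
      (fun y => φ (L.symm y)) t x
    simp only [LinearIsometryEquiv.coe_toContinuousLinearEquiv] at h1
    rw [h1, heatExtension_comp_linearIsometryEquiv L.symm φ t x]

/-- **The caloric test field is `O(E)`-covariant**: `e^{ντΔ}(L φ(L⁻¹ ·))(x) = L (e^{ντΔ}φ)(L⁻¹ x)`
(Fabes–Jones–Rivière 1972, §2; every `ν`, `τ`; the heat kernel is radial, Evans, *PDE*, §2.3.1). [cite: Evans2010, §2.3.1] -/
theorem heatTest_conj_linearIsometryEquiv (L : E ≃ₗᵢ[ℝ] E) (ν : ℝ) (φ : E → E) (τ : ℝ) (x : E) :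
    heatTest ν (fun y => L (φ (L.symm y))) τ x = L (heatTest ν φ τ (L.symm x)) :=
  heatFlow_conj_linearIsometryEquiv L φ (ν * τ) x

/-- Function form of `heatTest_conj_linearIsometryEquiv` (Evans, *PDE*, §2.3.1). [cite: Evans2010, §2.3.1] -/
theorem heatTest_conj_linearIsometryEquiv' (L : E ≃ₗᵢ[ℝ] E) (ν : ℝ) (φ : E → E) (τ : ℝ) :
    heatTest ν (fun y => L (φ (L.symm y))) τ = fun x => L (heatTest ν φ τ (L.symm x)) :=
  funext fun x => heatTest_conj_linearIsometryEquiv L ν φ τ x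

/-- **Covariance of the `L²` pairing**: `∫ ⟪L U(L⁻¹ x), Φ(x)⟫ dx = ∫ ⟪U(y), L⁻¹ Φ(L y)⟫ dy`
(substitute `x = L y`, `L` measure preserving, and `⟪L a, b⟫ = ⟪a, L⁻¹ b⟫; unconditional —
both sides are `0` together when non-integrable; Majda–Bertozzi 2002, §1.2, proof of
Prop. 1.1 (iii)). [cite: MajdaBertozziCUP2002, §1.2 Prop. 1.1 (iii)] -/
theorem integral_inner_conj_linearIsometryEquiv (L : E ≃ₗᵢ[ℝ] E) (U Φ : E → E) :
    ∫ x, ⟪L (U (L.symm x)), Φ x⟫ = ∫ y, ⟪U y, L.symm (Φ (L y))⟫ := by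
  have hmp : MeasurePreserving L volume volume := L.measurePreserving
  rw [← hmp.integral_comp L.toHomeomorph.measurableEmbedding]
  congr 1
  funext y
  simp only [LinearIsometryEquiv.symm_apply_apply]
  rw [LinearIsometryEquiv.inner_map_eq_flip]

end Heat

/-! ### The duality identity and the mild classes -/

section Mild

variable {E : Type*} [NormedAddCommGroup E] [InnerProductSpace ℝ E] [FiniteDimensional ℝ E]
  [MeasurableSpace E] [BorelSpace E]

/-- **Isometry covariance of the two-time duality identity** (Fabes–Jones–Rivière 1972, Thm. 2.1;
Majda–Bertozzi 2002, Prop. 1.1 (iii)): if the identity with viscosity `ν` and force `f` holds for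
`u` between `s` and `t`, it holds for `(τ, x) ↦ L (u τ (L⁻¹ x))` with force
`(τ, x) ↦ L (f τ (L⁻¹ x))`: each of the four terms, tested against `φ`, equals the corresponding
term for `u` tested against `L⁻¹ φ(L ·)` (`heatTest_conj_linearIsometryEquiv`,
`convect_conj_linearIsometryEquiv`, `integral_inner_conj_linearIsometryEquiv`). [cite: MajdaBertozziCUP2002, §1.2 Prop. 1.1 (iii)] -/
theorem IsMildNSSolutionBetween.conj_linearIsometryEquiv (L : E ≃ₗᵢ[ℝ] E) {ν : ℝ}
    {f u : ℝ → E → E} {s t : ℝ} (h : IsMildNSSolutionBetween ν f u s t) :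
    IsMildNSSolutionBetween ν (fun τ x => L (f τ (L.symm x))) (fun τ x => L (u τ (L.symm x)))
      s t := by
  intro φ hφ hdiv
  -- the conjugated test field `ψ = L⁻¹ φ (L ·)`
  have hψ : FunctionSpaces.IsTestFunctionOn (⊤ : Opens E) (fun x => L.symm (φ (L.symm.symm x))) :=
    hφ.conj_linearIsometryEquiv_top L.symm
  have hψdiv : VectorCalculus.IsDivFree (fun x => L.symm (φ (L.symm.symm x))) :=
    hdiv.conj_linearIsometryEquiv L.symm
  simp only [LinearIsometryEquiv.symm_symm] at hψ hψdiv
  have key := h _ hψ hψdiv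
  -- the caloric test field of `ψ` is the conjugate of that of `φ`
  have eH : ∀ σ : ℝ, heatTest ν (fun y => L.symm (φ (L y))) σ =
      fun y => L.symm (heatTest ν φ σ (L y)) := by
    intro σ
    have h1 := heatTest_conj_linearIsometryEquiv' L.symm ν φ σ
    simpa only [LinearIsometryEquiv.symm_symm] using h1
  -- left-hand side
  have e1 : ∫ x, ⟪L (u t (L.symm x)), φ x⟫ = ∫ y, ⟪u t y, L.symm (φ (L y))⟫ :=
    integral_inner_conj_linearIsometryEquiv L _ _
  -- linear terms (datum, force)
  have e2 : ∀ (w : E → E) (σ : ℝ), ∫ x, ⟪L (w (L.symm x)), heatTest ν φ σ x⟫ =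
      ∫ y, ⟪w y, heatTest ν (fun y => L.symm (φ (L y))) σ y⟫ := by
    intro w σ
    rw [integral_inner_conj_linearIsometryEquiv, eH]
  -- nonlinear term, slice by slice
  have e3 : ∀ τ : ℝ, ∫ x, ⟪L (u τ (L.symm x)),
      convect (fun x => L (u τ (L.symm x))) (heatTest ν φ (t - τ)) x⟫ =
      ∫ y, ⟪u τ y, convect (u τ) (heatTest ν (fun y => L.symm (φ (L y))) (t - τ)) y⟫ := by
    intro τ
    set w : E → E := fun y => L.symm (heatTest ν φ (t - τ) (L y)) with hw
    have hW : heatTest ν φ (t - τ) = fun x => L (w (L.symm x)) := by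
      funext x
      simp [hw]
    have hc : ∀ x, convect (fun x => L (u τ (L.symm x))) (heatTest ν φ (t - τ)) x =
        L (convect (u τ) w (L.symm x)) := by
      intro x
      rw [hW]
      exact convect_conj_linearIsometryEquiv L (u τ) w x
    simp_rw [hc]
    rw [integral_inner_conj_linearIsometryEquiv L (u τ) (fun x => L (convect (u τ) w (L.symm x))),
      eH (t - τ), ← hw]
    congr 1
    funext y
    simp
  simp_rw [e3]
  rw [e1, e2 (u s) (t - s)]
  simp_rw [e2 (f _) (t - _)]
  exact key

/-- Unforced case of `IsMildNSSolutionBetween.conj_linearIsometryEquiv` (the zero force is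
`O(E)`-invariant; KNSS 2009, §1). [cite: KochNadirashviliSereginSverak2009, §1] -/
theorem IsMildNSSolutionBetween.conj_linearIsometryEquiv_zero (L : E ≃ₗᵢ[ℝ] E) {ν : ℝ}
    {u : ℝ → E → E} {s t : ℝ} (h : IsMildNSSolutionBetween ν 0 u s t) :
    IsMildNSSolutionBetween ν 0 (fun τ x => L (u τ (L.symm x))) s t := by
  have h1 := h.conj_linearIsometryEquiv L
  have h0 : (fun τ x => L ((0 : ℝ → E → E) τ (L.symm x))) = 0 := by
    funext τ x
    simp
  rwa [h0] at h1

/-- **Isometry covariance of the duality identity from a datum**: conjugate solution, datum and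
force alike (Fabes–Jones–Rivière 1972, Thm. 2.1; Majda–Bertozzi 2002, Prop. 1.1 (iii)). [cite: MajdaBertozziCUP2002, §1.2 Prop. 1.1 (iii)] -/
theorem IsMildNSSolutionFrom.conj_linearIsometryEquiv (L : E ≃ₗᵢ[ℝ] E) {ν : ℝ} {f : ℝ → E → E}
    {u₀ : E → E} {u : ℝ → E → E} {t : ℝ} (h : IsMildNSSolutionFrom ν f u₀ u t) :
    IsMildNSSolutionFrom ν (fun τ x => L (f τ (L.symm x))) (fun x => L (u₀ (L.symm x)))
      (fun τ x => L (u τ (L.symm x))) t := by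
  -- `IsMildNSSolutionFrom ν f u₀ u t` is the two-time identity between `0` and `t` for the field
  -- `update`-free surrogate `v` with `v 0 = u₀`; we argue directly, term by term, as above.
  intro φ hφ hdiv
  have hψ : FunctionSpaces.IsTestFunctionOn (⊤ : Opens E) (fun x => L.symm (φ (L.symm.symm x))) :=
    hφ.conj_linearIsometryEquiv_top L.symm
  have hψdiv : VectorCalculus.IsDivFree (fun x => L.symm (φ (L.symm.symm x))) :=
    hdiv.conj_linearIsometryEquiv L.symm
  simp only [LinearIsometryEquiv.symm_symm] at hψ hψdiv
  have key := h _ hψ hψdiv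
  have eH : ∀ σ : ℝ, heatTest ν (fun y => L.symm (φ (L y))) σ =
      fun y => L.symm (heatTest ν φ σ (L y)) := by
    intro σ
    have h1 := heatTest_conj_linearIsometryEquiv' L.symm ν φ σ
    simpa only [LinearIsometryEquiv.symm_symm] using h1
  have e1 : ∫ x, ⟪L (u t (L.symm x)), φ x⟫ = ∫ y, ⟪u t y, L.symm (φ (L y))⟫ :=
    integral_inner_conj_linearIsometryEquiv L _ _
  have e2 : ∀ (w : E → E) (σ : ℝ), ∫ x, ⟪L (w (L.symm x)), heatTest ν φ σ x⟫ =
      ∫ y, ⟪w y, heatTest ν (fun y => L.symm (φ (L y))) σ y⟫ := by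
    intro w σ
    rw [integral_inner_conj_linearIsometryEquiv, eH]
  have e3 : ∀ τ : ℝ, ∫ x, ⟪L (u τ (L.symm x)),
      convect (fun x => L (u τ (L.symm x))) (heatTest ν φ (t - τ)) x⟫ =
      ∫ y, ⟪u τ y, convect (u τ) (heatTest ν (fun y => L.symm (φ (L y))) (t - τ)) y⟫ := by
    intro τ
    set w : E → E := fun y => L.symm (heatTest ν φ (t - τ) (L y)) with hw
    have hW : heatTest ν φ (t - τ) = fun x => L (w (L.symm x)) := by
      funext x
      simp [hw]
    have hc : ∀ x, convect (fun x => L (u τ (L.symm x))) (heatTest ν φ (t - τ)) x =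
        L (convect (u τ) w (L.symm x)) := by
      intro x
      rw [hW]
      exact convect_conj_linearIsometryEquiv L (u τ) w x
    simp_rw [hc]
    rw [integral_inner_conj_linearIsometryEquiv L (u τ) (fun x => L (convect (u τ) w (L.symm x))),
      eH (t - τ), ← hw]
    congr 1
    funext y
    simp
  simp_rw [e3]
  rw [e1, e2 u₀ t]
  simp_rw [e2 (f _) (t - _)]
  exact key

/-- **Isometry covariance of mild solutions on a time set** (weak divergence-freeness of the
slices: `IsWeaklyDivFree.conj_linearIsometryEquiv`; duality identity:
`IsMildNSSolutionFrom.conj_linearIsometryEquiv`). [cite: MajdaBertozziCUP2002, §1.2 Prop. 1.1 (iii)] -/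
theorem IsMildNSSolutionOn.conj_linearIsometryEquiv (L : E ≃ₗᵢ[ℝ] E) {S : Set ℝ} {ν : ℝ}
    {f : ℝ → E → E} {u₀ : E → E} {u : ℝ → E → E} (h : IsMildNSSolutionOn S ν f u₀ u) :
    IsMildNSSolutionOn S ν (fun τ x => L (f τ (L.symm x))) (fun x => L (u₀ (L.symm x)))
      (fun τ x => L (u τ (L.symm x))) :=
  ⟨fun t ht => (h.1 t ht).conj_linearIsometryEquiv L, fun t ht => (h.2 t ht).conj_linearIsometryEquiv L⟩

omit [FiniteDimensional ℝ E] [MeasurableSpace E] [BorelSpace E] in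
/-- **Boundedness on a time set is `O(E)`-invariant** (`‖L v‖ = ‖v‖`; KNSS 2009, §1: bounded
ancient solutions, a rotation-invariant class). [cite: KochNadirashviliSereginSverak2009, §1] -/
theorem IsBoundedOn.conj_linearIsometryEquiv (L : E ≃ₗᵢ[ℝ] E) {S : Set ℝ} {u : ℝ → E → E}
    (h : IsBoundedOn S u) : IsBoundedOn S (fun τ x => L (u τ (L.symm x))) := by
  obtain ⟨C, hC⟩ := h
  refine ⟨C, fun t ht x => ?_⟩
  rw [LinearIsometryEquiv.norm_map]
  exact hC t ht _

/-- **Ancient mild solutions are `O(E)`-covariant** (KNSS 2009, §1: the class of ancient (mild)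
solutions on `(-∞, 0) × E` is invariant under the symmetries of the Navier–Stokes equations, in
particular under `u ↦ L u(t, L⁻¹ ·)` for a linear isometry `L`). [cite: KochNadirashviliSereginSverak2009, §1] -/
theorem IsAncientMildSolution.conj_linearIsometryEquiv (L : E ≃ₗᵢ[ℝ] E) {ν : ℝ} {u : ℝ → E → E}
    (h : IsAncientMildSolution ν u) : IsAncientMildSolution ν (fun t x => L (u t (L.symm x))) :=
  ⟨fun t ht => (h.1 t ht).conj_linearIsometryEquiv L,
    fun s t hst ht => (h.2 s t hst ht).conj_linearIsometryEquiv_zero L⟩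

/-- **Bounded ancient mild solutions are `O(E)`-covariant**, with the same bound (KNSS 2009, §1:
the objects of the Liouville conjecture form a rotation-invariant class). [cite: KochNadirashviliSereginSverak2009, §1] -/
theorem IsBoundedAncientMildSolution.conj_linearIsometryEquiv (L : E ≃ₗᵢ[ℝ] E) {ν : ℝ}
    {u : ℝ → E → E} (h : IsBoundedAncientMildSolution ν u) :
    IsBoundedAncientMildSolution ν (fun t x => L (u t (L.symm x))) :=
  ⟨h.1.conj_linearIsometryEquiv L, h.2.conj_linearIsometryEquiv L⟩

/-- Slice measurability is `O(E)`-invariant (`L⁻¹` is measure preserving, `L` continuous; KNSS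
2009, §1). [cite: KochNadirashviliSereginSverak2009, §1] -/
theorem aestronglyMeasurable_conj_linearIsometryEquiv (L : E ≃ₗᵢ[ℝ] E) {v : E → E}
    (hv : AEStronglyMeasurable v volume) :
    AEStronglyMeasurable (fun x => L (v (L.symm x))) volume :=
  L.continuous.comp_aestronglyMeasurable (hv.comp_measurePreserving L.symm.measurePreserving)

/-- **An a.e.-vanishing slice stays a.e.-vanishing under conjugation** (`L⁻¹` is measure
preserving, `L 0 = 0`; the conclusion `u ≡ 0` of the Liouville theorems, KNSS 2009, §1, is
rotation invariant). [cite: KochNadirashviliSereginSverak2009, §1] -/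
theorem ae_eq_zero_conj_linearIsometryEquiv (L : E ≃ₗᵢ[ℝ] E) {v : E → E}
    (hv : v =ᵐ[volume] 0) : (fun x => L (v (L.symm x))) =ᵐ[volume] 0 := by
  have h1 : (v ∘ L.symm) =ᵐ[volume] ((0 : E → E) ∘ L.symm) :=
    L.symm.measurePreserving.quasiMeasurePreserving.ae_eq_comp hv
  filter_upwards [h1] with x hx
  simp only [Function.comp_apply, Pi.zero_apply] at hx
  simp [hx]

end Mild

/-! ### Type I bounds and (rotated, discrete) self-similarity -/

section Decay

variable {E : Type*} [NormedAddCommGroup E] [InnerProductSpace ℝ E]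

/-- **The Type I space–time bound is `O(E)`-invariant**: `HasTypeIDecay C u → HasTypeIDecay C (L u L⁻¹)`
(KNSS 2009, (1.6): the bound only involves `‖x‖ = ‖L⁻¹ x‖` and `‖L v‖ = ‖v‖`). [cite: KochNadirashviliSereginSverak2009, §1 (1.6)] -/
theorem HasTypeIDecay.conj_linearIsometryEquiv (L : E ≃ₗᵢ[ℝ] E) {C : ℝ} {u : ℝ → E → E}
    (h : HasTypeIDecay C u) : HasTypeIDecay C (fun t x => L (u t (L.symm x))) := by
  intro t ht x
  have key := h t ht (L.symm x)
  rw [LinearIsometryEquiv.norm_map] at key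
  rw [LinearIsometryEquiv.norm_map]
  exact key

/-- **The Type I bound in time is `O(E)`-invariant** (KNSS 2009, (1.4)). [cite: KochNadirashviliSereginSverak2009, §1 (1.4)] -/
theorem HasTypeITimeDecay.conj_linearIsometryEquiv (L : E ≃ₗᵢ[ℝ] E) {C : ℝ} {u : ℝ → E → E}
    (h : HasTypeITimeDecay C u) : HasTypeITimeDecay C (fun t x => L (u t (L.symm x))) := by
  intro t ht x
  rw [LinearIsometryEquiv.norm_map]
  exact h t ht _

/-- **The parabolic rescaling commutes with conjugation by a linear isometry**:
`(L u L⁻¹)_λ = L u_λ L⁻¹` (`L (λ v) = λ L v`, `L⁻¹ (λ x) = λ L⁻¹ x`; Leray 1934, §20). [cite: Leray1934, §20] -/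
theorem nsRescale_conj_linearIsometryEquiv (L : E ≃ₗᵢ[ℝ] E) (c : ℝ) (u : ℝ → E → E) :
    nsRescale c (fun t x => L (u t (L.symm x))) = fun t x => L (nsRescale c u t (L.symm x)) := by
  funext t x
  simp only [nsRescale_apply, map_smul]

/-- **Discrete self-similarity is `O(E)`-invariant**: a `λ`-DSS field conjugated by a linear
isometry is `λ`-DSS (Chae–Wolf 2017, Def. 1.1 with `R = 1`). [cite: ChaeWolf2017, Def. 1.1] -/
theorem IsDiscretelySelfSimilar.conj_linearIsometryEquiv (L : E ≃ₗᵢ[ℝ] E) {c : ℝ}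
    {u : ℝ → E → E} (h : IsDiscretelySelfSimilar c u) :
    IsDiscretelySelfSimilar c (fun t x => L (u t (L.symm x))) := by
  unfold IsDiscretelySelfSimilar at h ⊢
  rw [nsRescale_conj_linearIsometryEquiv, h]

/-- **Self-similarity is `O(E)`-invariant** (Leray 1934, (3.11), §20). [cite: Leray1934, §20] -/
theorem IsSelfSimilar.conj_linearIsometryEquiv (L : E ≃ₗᵢ[ℝ] E) {u : ℝ → E → E}
    (h : IsSelfSimilar u) : IsSelfSimilar (fun t x => L (u t (L.symm x))) :=
  fun c hc => (IsDiscretelySelfSimilar.conj_linearIsometryEquiv L (h c hc) :)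

/-- **Rotated discrete self-similarity is `O(E)`-covariant**: if `u` is rotated `λ`-DSS with
rotation `R` then `L u L⁻¹` is rotated `λ`-DSS with the conjugate rotation `L R L⁻¹`
(= `(L.symm.trans R).trans L`; Chae–Wolf 2017, Def. 1.1). [cite: ChaeWolf2017, Def. 1.1] -/
theorem IsRotatedDSS.conj_linearIsometryEquiv (L : E ≃ₗᵢ[ℝ] E) {c : ℝ} {R : E ≃ₗᵢ[ℝ] E}
    {u : ℝ → E → E} (h : IsRotatedDSS c R u) :
    IsRotatedDSS c ((L.symm.trans R).trans L) (fun t x => L (u t (L.symm x))) := by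
  intro t x
  have key := h t (L.symm x)
  simp only [LinearIsometryEquiv.symm_trans, LinearIsometryEquiv.coe_trans, Function.comp_apply,
    LinearIsometryEquiv.symm_symm, map_smul, LinearIsometryEquiv.symm_apply_apply]
  rw [← key, map_smul]

end Decay

end Literature.Analysis.FluidPDE
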